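import Literature.NumberTheory.NumberFields.EquivariantIwasawaLemma
import Literature.NumberTheory.NumberFields.ClassNumberPExtensionOnePrime
import Literature.NumberTheory.NumberFields.UnramifiedAbelianBaseChange
import HarnessLib

/-!
# The equivariant Iwasawa lemma, III: the base hypothesis from the class group of `B`
# (equivariant Artin reciprocity for `B`), and the lemma with class-group hypotheses only

Topic `NumberTheory/NumberFields` (namespace = path, grouping sub-namespace `EquivariantIwasawaLemma`).
THEOREM-ONLY file (no definition, no named fact, no `sorry`), written by the literature seat
`bsd-potss-conjA-anchor` g16 (cell `bsd-potss`; serves stmt-BirchSwinnertonDyer-19386 / 19413; closes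
nothing; neither Conjecture A nor BSD is proved for any curve here).  Sequel of
`EquivariantIwasawaLemma.lean`, whose theorem `equivariantHom_classGroup_eq_zero_of_cyclic_layer` takes
hypothesis (c2*) at the base `B` in GALOIS-SIDE form:

> every additive `χ : Gal(H_F/B) → V`, killing the inertia group of every prime of `H_F` and
> `Γ`-equivariant under conjugation, vanishes.

## Results

* `inertiaTrivialHom_eq_zero_of_classGroupHom_eq_zero` — that Galois-side statement FOLLOWS from the
  class-group form **`Hom_Γ(Cl(B), V) = 0`** (every additive `μ : Cl(𝓞_B) → V` with
  `μ(τ|_B · c) = τ • μ(c)` is zero), for `k ⊆ B ⊆ F` number fields, `F/k` and `B/k` Galois, `F/B`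
  unramified at the infinite places (automatic in odd degree).  PROOF (Cox Thm. 8.10 / Neukirch VI (6.9)
  with the equivariance of the Artin symbol, Neukirch IV §6): `K = ker χ ≤ G = Gal(H_F/B)` is normal,
  contains the commutators and the inertia groups, and is stable under `Gal(H_F/k)`-conjugation
  (equivariance); its fixed field `P` is therefore Galois over `B` with abelian group `G/K ↪ V`,
  unramified at every finite prime (`I(𝔔) ≤ K`, tree `isUnramifiedAt_under_iff_inertia_le'`) and at
  infinity, and stable under `Gal(H_F/k)`.  Embedding `H_F` into `B̄` (`IsAlgClosed.lift`) carries `P` to a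
  subfield `P♭` of the Hilbert class field `H_B` (maximality, tree `le_hilbertClassField`), so `χ`
  induces an additive `μ : Cl(B) ≅ Gal(H_B/B) ↠ Gal(P♭/B) ≅ Gal(P/B) = G/K → V`.  It is `Γ`-equivariant:
  lift `π(τ) ∈ Gal(F/k)` to `ω ∈ Aut(B̄/k)` (`AlgEquiv.liftNormal`); `ω` restricts to `τ̃ ∈ Gal(H_B/k)`
  over `τ|_B`, for which the Artin isomorphism is equivariant (tree
  `hilbertClassField.artinEquiv_mulEquiv_intAut_apply`: `(H_B/B, τ𝔞) = τ̃ (H_B/B, 𝔞) τ̃⁻¹`), and, through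
  the embedding, to `g̃ ∈ Gal(H_F/k)` over `π(τ)`, for which `χ` is equivariant; the two agree on
  `P ≅ P♭`.  Hence `μ = 0`, and `χ = 0` because every element of `Gal(P/B)` lifts.
* **`equivariantHom_classGroup_eq_zero_of_cyclic_layer_of_classGroup`** — the EQUIVARIANT IWASAWA
  LEMMA with class-group hypotheses only: `[F : B] = p`, `Gal(F/B)` central in `Gal(F/k)`, `V` a
  `p`-torsion `Γ`-module through `π : Γ ↠ Gal(F/k)` on which the elements over `Gal(F/B)` act trivially,
  (c2*) `Hom_Γ(Cl(B), V) = 0`, (c3*) `V^{D_𝔓} = 0` for the primes `𝔓` of `F` ramified over `B` and one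
  ramified prime with a number of conjugates prime to `p` ⟹ `Hom_Γ(Cl(F), V) = 0`.  For the cyclotomic
  tower `L_n = ℚ(E[p])ℚ_n` (`p ∤ #Gal(ℚ(E[p])/ℚ)`, `E(ℚ_p)[p] = 0`) this is the induction step
  `Hom_G(Cl(L_n), E[p]) = 0 ⟹ Hom_G(Cl(L_{n+1}), E[p]) = 0` («door L6» of the cell's census), i.e. the
  `E[p]`-isotypic refinement of Iwasawa's `p ∤ h` lemma (Washington Thm. 10.4), by class field theory.

## References

* L. C. Washington, *Introduction to Cyclotomic Fields*, 2nd ed., GTM 83 (1997), §13.3 Lemmas 13.14–13.15,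
  Thm. 10.4. [Washington1997]
* J. Neukirch, *Algebraic Number Theory* (1999), Ch. VI (6.9), (7.1); Ch. IV §6. [NeukirchANT1999]
* D. A. Cox, *Primes of the form x² + ny²*, 2nd ed. (2013), §8.A Thm. 8.10, §5.C Cor. 5.24. [Cox2013]
-/

noncomputable section

open scoped Pointwise commutatorElement
open NumberField IsDedekindDomain Ideal

namespace Literature.NumberTheory.NumberFields

namespace EquivariantIwasawaLemma

open Literature.NumberTheory.NumberFields.hilbertClassField

section ClassGroup

variable {k B F : Type} [Field k] [Field B] [NumberField B] [Field F] [NumberField F]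
  [Algebra k B] [Algebra k F] [Algebra B F] [IsScalarTower k B F] [IsGalois k F] [IsGalois k B]
  [IsUnramifiedAtInfinitePlaces B F]

omit [NumberField B] [NumberField F] [Algebra k F] [Algebra B F] [IsScalarTower k B F] [IsGalois k F]
  [IsUnramifiedAtInfinitePlaces B F] in
/-- `g̃⁻¹` moves `B` by `(g̃|_B)⁻¹`. [folklore] -/
private theorem symm_algebraMap' {E : Type*} [Field E] [Algebra k E] [Algebra B E] [IsScalarTower k B E]
    (g : E ≃ₐ[k] E) (x : B) :
    g.symm (algebraMap B E x) = algebraMap B E ((g.restrictNormal B).symm x) := by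
  apply g.injective
  rw [AlgEquiv.apply_symm_apply, ← AlgEquiv.restrictNormal_commutes, AlgEquiv.apply_symm_apply]

omit [NumberField B] [NumberField F] [Algebra k F] [Algebra B F] [IsScalarTower k B F] [IsGalois k F]
  [IsUnramifiedAtInfinitePlaces B F] in
/-- For `g̃ ∈ Aut(E/k)` and `σ ∈ Aut(E/B)` (`B/k` normal) the conjugate `g̃ σ g̃⁻¹` is `B`-linear.
[folklore] -/
private theorem exists_conj' {E : Type*} [Field E] [Algebra k E] [Algebra B E] [IsScalarTower k B E]
    (g : E ≃ₐ[k] E) (σ : E ≃ₐ[B] E) :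
    ∃ σ' : E ≃ₐ[B] E, ∀ y, σ' y = g (σ (g.symm y)) := by
  refine ⟨AlgEquiv.ofRingEquiv (f := g.symm.toRingEquiv.trans (σ.toRingEquiv.trans g.toRingEquiv))
    fun x => ?_, fun y => rfl⟩
  change g (σ (g.symm (algebraMap B E x))) = algebraMap B E x
  rw [symm_algebraMap', AlgEquiv.commutes, ← AlgEquiv.restrictNormal_commutes, AlgEquiv.apply_symm_apply]

set_option maxHeartbeats 2000000 in
/-- **Galois side from class-group side.**  `k ⊆ B ⊆ F` number fields, `F/k` and `B/k` Galois, `F/B`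
unramified at the infinite places; `Γ` acts on `V` through `π : Γ ↠ Gal(F/k)`.  If every `Γ`-equivariant
additive `μ : Cl(𝓞_B) → V` is zero, then every additive `χ : Gal(H_F/B) → V` killing all inertia groups
and `Γ`-equivariant under conjugation is zero (`H_F` the Hilbert class field of `F`): the fixed field of
`ker χ` is an abelian extension of `B` unramified at all places, hence inside the Hilbert class field of
`B`, where the Artin isomorphism `Cl(𝓞_B) ≅ Gal(H_B/B)` is equivariant.
[cite: Cox2013, §8.A Thm. 8.10 and §5.C Cor. 5.24]
[cite: NeukirchANT1999, Ch. VI (6.9), (7.1) and Ch. IV §6 (equivariance of the Artin symbol)] -/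
theorem inertiaTrivialHom_eq_zero_of_classGroupHom_eq_zero
    {Γ : Type*} [Group Γ] (π : Γ →* (F ≃ₐ[k] F)) (hπ : Function.Surjective π)
    {V : Type*} [AddCommGroup V] [DistribMulAction Γ V]
    (h0 : ∀ μ : Additive (ClassGroup (𝓞 B)) →+ V,
      (∀ (τ : Γ) (c : ClassGroup (𝓞 B)),
        μ (Additive.ofMul (ClassGroup.mulEquiv (AmbiguousClass.intAut ((π τ).restrictNormal B)) c)) =
          τ • μ (Additive.ofMul c)) → μ = 0)
    (χ : (hilbertClassField F ≃ₐ[B] hilbertClassField F) → V)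
    (hχadd : ∀ a b, χ (a * b) = χ a + χ b)
    (hχI : ∀ (Q : Ideal (𝓞 (hilbertClassField F))) [Q.IsMaximal],
      ∀ s ∈ Q.inertia (hilbertClassField F ≃ₐ[B] hilbertClassField F), χ s = 0)
    (hχequiv : ∀ (τ : Γ) (g : hilbertClassField F ≃ₐ[k] hilbertClassField F)
      (a a' : hilbertClassField F ≃ₐ[B] hilbertClassField F),
      AlgEquiv.restrictNormalHom F g = π τ → (∀ y, a' y = g (a (g.symm y))) → χ a' = τ • χ a)
    (a : hilbertClassField F ≃ₐ[B] hilbertClassField F) : χ a = 0 := by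
  classical
  -- ### Galois setup
  haveI : CharZero k := (algebraMap k F).charZero
  haveI : FiniteDimensional k F := Module.Finite.of_restrictScalars_finite ℚ k F
  haveI : FiniteDimensional k B := Module.Finite.of_restrictScalars_finite ℚ k B
  haveI : IsGalois B F := IsGalois.tower_top_of_isGalois k B F
  haveI : IsScalarTower k F (hilbertClassField F) :=
    IsScalarTower.of_algebraMap_eq fun x => Subtype.ext (IsScalarTower.algebraMap_apply k F _ x)
  haveI : IsScalarTower B F (hilbertClassField F) :=
    IsScalarTower.of_algebraMap_eq fun x => Subtype.ext (IsScalarTower.algebraMap_apply B F _ x)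
  haveI : IsScalarTower k B (hilbertClassField F) := IsScalarTower.of_algebraMap_eq fun x => by
    rw [IsScalarTower.algebraMap_apply B F (hilbertClassField F),
      ← IsScalarTower.algebraMap_apply k B F, ← IsScalarTower.algebraMap_apply k F (hilbertClassField F)]
  haveI : IsGalois k (hilbertClassField F) := hilbertClassField.isGalois_of_isGalois F (K := k)
  haveI : IsGalois B (hilbertClassField F) := hilbertClassField.isGalois_of_isGalois F (K := B)
  haveI : FiniteDimensional B (hilbertClassField F) := Module.Finite.trans F (hilbertClassField F)
  haveI : IsUnramifiedAtInfinitePlaces B (hilbertClassField F) :=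
    IsUnramifiedAtInfinitePlaces.trans B F (hilbertClassField F)
  haveI : IsGalois k (hilbertClassField B) := hilbertClassField.isGalois_of_isGalois B (K := k)
  obtain ⟨rk, hrk⟩ : ∃ rk : (hilbertClassField F ≃ₐ[k] hilbertClassField F) →* (F ≃ₐ[k] F),
      rk = AlgEquiv.restrictNormalHom F := ⟨_, rfl⟩
  have hrk_apply : ∀ g x, algebraMap F (hilbertClassField F) (rk g x) = g (algebraMap F _ x) := by
    intro g x; rw [hrk]; exact AlgEquiv.restrictNormal_commutes g F x
  have hrk_surj : Function.Surjective rk := by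
    rw [hrk]; exact AlgEquiv.restrictNormalHom_surjective (hilbertClassField F)
  have hχ1 : χ 1 = 0 := by
    have h := hχadd 1 1; rw [mul_one] at h; exact left_eq_add.mp h
  -- ### `K = ker χ`, a normal subgroup containing commutators and inertia, stable under `Gal(H_F/k)`
  let χ' : (hilbertClassField F ≃ₐ[B] hilbertClassField F) →* Multiplicative V :=
    { toFun := fun a => Multiplicative.ofAdd (χ a)
      map_one' := by rw [hχ1]; rfl
      map_mul' := fun a b => by rw [hχadd]; rfl }
  obtain ⟨K, hK⟩ : ∃ K : Subgroup (hilbertClassField F ≃ₐ[B] hilbertClassField F), K = χ'.ker := ⟨_, rfl⟩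
  have hmemK : ∀ x, x ∈ K ↔ χ x = 0 := fun x => by
    rw [hK, MonoidHom.mem_ker]; exact ofAdd_eq_one
  haveI hKn : K.Normal := by rw [hK]; infer_instance
  have hcommK : ⁅(⊤ : Subgroup (hilbertClassField F ≃ₐ[B] hilbertClassField F)), ⊤⁆ ≤ K := by
    rw [Subgroup.commutator_le]
    intro g _ h _
    rw [hK, MonoidHom.mem_ker, map_commutatorElement, commutatorElement_eq_one_iff_mul_comm, mul_comm]
  have hIK : ∀ (Q : Ideal (𝓞 (hilbertClassField F))) [Q.IsMaximal],
      Q.inertia (hilbertClassField F ≃ₐ[B] hilbertClassField F) ≤ K :=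
    fun Q _ s hs => (hmemK s).mpr (hχI Q s hs)
  have hKconj : ∀ (g : hilbertClassField F ≃ₐ[k] hilbertClassField F)
      (n n' : hilbertClassField F ≃ₐ[B] hilbertClassField F),
      n ∈ K → (∀ y, n' y = g (n (g.symm y))) → n' ∈ K := by
    intro g n n' hn hn'
    obtain ⟨τ, hτ⟩ := hπ (rk g)
    rw [hmemK] at hn ⊢
    rw [hχequiv τ g n n' (by rw [← hrk, hτ]) hn', hn, smul_zero]
  -- ### the fixed field `P` of `K`: abelian, unramified, `Gal(H_F/k)`-stable
  obtain ⟨P, hP⟩ : ∃ P : IntermediateField B (hilbertClassField F), P = IntermediateField.fixedField K :=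
    ⟨_, rfl⟩
  haveI : IsGalois B P := by rw [hP]; exact IsGalois.of_fixedField_normal_subgroup K
  haveI : NumberField P := NumberField.of_module_finite B P
  have hPfix : P.fixingSubgroup = K := by rw [hP, IntermediateField.fixingSubgroup_fixedField]
  -- `Gal(H_F/B) → Gal(P/B)` with kernel `K`
  obtain ⟨resP, hresP⟩ : ∃ resP : (hilbertClassField F ≃ₐ[B] hilbertClassField F) →* (P ≃ₐ[B] P),
      resP = AlgEquiv.restrictNormalHom P := ⟨_, rfl⟩
  have hresP_val : ∀ g (x : P), ((resP g x : P) : hilbertClassField F) = g (x : hilbertClassField F) := by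
    intro g x; rw [hresP]; exact AlgEquiv.restrictNormal_commutes g P x
  have hresP_surj : Function.Surjective resP := by
    rw [hresP]; exact AlgEquiv.restrictNormalHom_surjective (hilbertClassField F)
  have hresP_K : ∀ n, n ∈ K → resP n = 1 := by
    intro n hn
    rw [← hPfix, IntermediateField.mem_fixingSubgroup_iff] at hn
    apply AlgEquiv.ext
    intro x
    apply Subtype.ext
    rw [hresP_val, AlgEquiv.one_apply]
    exact hn x x.2
  have hresP_ker : ∀ g g', resP g = resP g' → χ g = χ g' := by
    intro g g' h
    have hmem : g⁻¹ * g' ∈ K := by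
      rw [← hPfix, IntermediateField.mem_fixingSubgroup_iff]
      intro x hx
      have h1 : g' x = g x := by
        rw [← hresP_val g' ⟨x, hx⟩, ← hresP_val g ⟨x, hx⟩, h]
      rw [AlgEquiv.mul_apply, h1, AlgEquiv.aut_inv, AlgEquiv.symm_apply_apply]
    have : g' = g * (g⁻¹ * g') := by group
    rw [this, hχadd, (hmemK _).mp hmem, add_zero]
  haveI : IsAbelianGalois B P := by
    refine { is_comm := ⟨fun x y => ?_⟩ }
    obtain ⟨g, rfl⟩ := hresP_surj x
    obtain ⟨g', rfl⟩ := hresP_surj y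
    rw [← map_mul, ← map_mul]
    have hk : g * g' * (g' * g)⁻¹ ∈ K := by
      apply hcommK
      have : g * g' * (g' * g)⁻¹ = ⁅g, g'⁆ := by rw [commutatorElement_def]; group
      rw [this]
      exact Subgroup.commutator_mem_commutator (Subgroup.mem_top g) (Subgroup.mem_top g')
    have hk' := hresP_K _ hk
    rwa [map_mul, map_inv, mul_inv_eq_one] at hk'
  haveI : IsUnramifiedAtInfinitePlaces B P :=
    isUnramifiedAtInfinitePlaces_of_algHom (IsScalarTower.toAlgHom B P (hilbertClassField F))
  have hunrP : ∀ v : HeightOneSpectrum (𝓞 B), Algebra.IsUnramifiedIn (𝓞 P) v.asIdeal := by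
    intro v q hq hqv
    haveI := hq
    have hq0 : q ≠ ⊥ := by
      intro h0
      apply v.ne_bot
      rw [hqv.over, h0, Ideal.under_def, Ideal.comap_bot_of_injective _
        (FaithfulSMul.algebraMap_injective (𝓞 B) (𝓞 P))]
    haveI : q.IsMaximal := hq.isMaximal hq0
    obtain ⟨Q, hQmax, hQq⟩ := Ideal.exists_maximal_ideal_liesOver_of_isIntegral (S := 𝓞 (hilbertClassField F)) q
    haveI := hQmax
    have hq' : q = Q.under (𝓞 P) := hQq.over
    subst hq'
    rw [isUnramifiedAt_under_iff_inertia_le' P Q, hPfix]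
    exact hIK Q
  have hPstab : ∀ (g : hilbertClassField F ≃ₐ[k] hilbertClassField F) (x : hilbertClassField F),
      x ∈ P → g x ∈ P := by
    intro g x hx
    rw [hP, IntermediateField.mem_fixedField_iff] at hx ⊢
    intro n hn
    obtain ⟨n', hn'⟩ := exists_conj' g.symm n
    have hn'K : n' ∈ K := hKconj g.symm n n' hn hn'
    have h := hx n' hn'K
    rw [hn', AlgEquiv.symm_symm] at h
    -- `g⁻¹ (n (g x)) = x`
    have h2 := congrArg g h
    rwa [AlgEquiv.apply_symm_apply] at h2
  -- ### embedding into `B̄` and the Hilbert class field of `B`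
  let ψ : hilbertClassField F →ₐ[B] AlgebraicClosure B := IsAlgClosed.lift
  obtain ⟨Pb, hPb⟩ : ∃ Pb : IntermediateField B (AlgebraicClosure B), Pb = P.map ψ := ⟨_, rfl⟩
  let e : P ≃ₐ[B] Pb := (IntermediateField.equivMap P ψ).trans (IntermediateField.equivOfEq hPb.symm)
  have he_val : ∀ x : P, ((e x : Pb) : AlgebraicClosure B) = ψ (x : hilbertClassField F) := fun _ => rfl
  haveI : FiniteDimensional B Pb := LinearEquiv.finiteDimensional e.toLinearEquiv
  haveI : NumberField Pb := NumberField.of_module_finite B Pb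
  haveI : IsAbelianGalois B Pb := IsAbelianGalois.of_algHom (e.symm : Pb →ₐ[B] P)
  haveI : IsUnramifiedAtInfinitePlaces B Pb := isUnramifiedAtInfinitePlaces_of_algHom (e.symm : Pb →ₐ[B] P)
  have hunrPb := forall_isUnramifiedIn_of_algHom (e.symm : Pb →ₐ[B] P) hunrP
  have hle : Pb ≤ hilbertClassField B := le_hilbertClassField B Pb hunrPb
  -- `Gal(H_B/B) → Gal(P♭/B)`
  letI algPb : Algebra Pb (hilbertClassField B) := (IntermediateField.inclusion hle).toRingHom.toAlgebra
  haveI : IsScalarTower B Pb (hilbertClassField B) := IsScalarTower.of_algebraMap_eq fun _ => rfl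
  have hincl_val : ∀ y : Pb, ((algebraMap Pb (hilbertClassField B) y : hilbertClassField B) :
      AlgebraicClosure B) = (y : AlgebraicClosure B) := fun _ => rfl
  obtain ⟨resPb, hresPb⟩ : ∃ resPb : (hilbertClassField B ≃ₐ[B] hilbertClassField B) →* (Pb ≃ₐ[B] Pb),
      resPb = AlgEquiv.restrictNormalHom Pb := ⟨_, rfl⟩
  have hresPb_val : ∀ h (y : Pb), ((resPb h y : Pb) : AlgebraicClosure B) =
      ((h (algebraMap Pb (hilbertClassField B) y) : hilbertClassField B) : AlgebraicClosure B) := by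
    intro h y
    rw [← hincl_val (resPb h y), hresPb]
    exact congrArg (fun z : hilbertClassField B => (z : AlgebraicClosure B))
      (AlgEquiv.restrictNormal_commutes h Pb y)
  have hresPb_surj : Function.Surjective resPb := by
    rw [hresPb]; exact AlgEquiv.restrictNormalHom_surjective (hilbertClassField B)
  -- the transported functional `ν` on `Gal(P/B)` and `μ` on `Cl(B)`
  let L : (P ≃ₐ[B] P) → (hilbertClassField F ≃ₐ[B] hilbertClassField F) := Function.surjInv hresP_surj
  have hL : ∀ w, resP (L w) = w := Function.surjInv_eq hresP_surj
  let eaut : (P ≃ₐ[B] P) ≃* (Pb ≃ₐ[B] Pb) := e.autCongr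
  have heaut : ∀ w y, eaut w y = e (w (e.symm y)) := fun _ _ => rfl
  let μ : ClassGroup (𝓞 B) → V := fun c => χ (L (eaut.symm (resPb (artinEquiv B c))))
  have hμ_of : ∀ c g, resP g = eaut.symm (resPb (artinEquiv B c)) → μ c = χ g := by
    intro c g hg
    exact hresP_ker _ _ (by rw [hL, hg])
  have hμmul : ∀ c c', μ (c * c') = μ c + μ c' := by
    intro c c'
    rw [hμ_of (c * c') (L (eaut.symm (resPb (artinEquiv B c))) * L (eaut.symm (resPb (artinEquiv B c'))))
      (by rw [map_mul, hL, hL, map_mul, map_mul, map_mul]), hχadd]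
  let μ' : Additive (ClassGroup (𝓞 B)) →+ V :=
    AddMonoidHom.mk' (fun c => μ (Additive.toMul c)) fun c c' => by
      rw [toMul_add, hμmul]
  -- ### equivariance of `μ`
  have hμequiv : ∀ (τ : Γ) (c : ClassGroup (𝓞 B)),
      μ' (Additive.ofMul (ClassGroup.mulEquiv (AmbiguousClass.intAut ((π τ).restrictNormal B)) c)) =
        τ • μ' (Additive.ofMul c) := by
    intro τ c
    simp only [μ', AddMonoidHom.mk'_apply, toMul_ofMul]
    -- the element `a₀` computing `μ c`, and its conjugate
    obtain ⟨a₀, ha₀⟩ : ∃ a₀, a₀ = L (eaut.symm (resPb (artinEquiv B c))) := ⟨_, rfl⟩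
    have hμc : μ c = χ a₀ := by rw [ha₀]
    have ha₀r : resP a₀ = eaut.symm (resPb (artinEquiv B c)) := by rw [ha₀, hL]
    have hPbArt : resPb (artinEquiv B c) = eaut (resP a₀) := by rw [ha₀r, MulEquiv.apply_symm_apply]
    -- `ω ∈ Aut(B̄/k)` over `π τ`, its restrictions `τ̃` to `H_B` and `g̃` to `H_F`
    let ψF : F →ₐ[B] AlgebraicClosure B := ψ.comp (IsScalarTower.toAlgHom B F (hilbertClassField F))
    letI algF : Algebra F (AlgebraicClosure B) := ψF.toRingHom.toAlgebra
    haveI : IsScalarTower B F (AlgebraicClosure B) := IsScalarTower.of_algebraMap_eq fun x => (ψF.commutes x).symm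
    haveI : IsScalarTower k F (AlgebraicClosure B) := IsScalarTower.of_algebraMap_eq fun x => by
      rw [IsScalarTower.algebraMap_apply k B (AlgebraicClosure B), IsScalarTower.algebraMap_apply k B F,
        ← IsScalarTower.algebraMap_apply B F (AlgebraicClosure B)]
    letI algH : Algebra (hilbertClassField F) (AlgebraicClosure B) := ψ.toRingHom.toAlgebra
    haveI : IsScalarTower B (hilbertClassField F) (AlgebraicClosure B) :=
      IsScalarTower.of_algebraMap_eq fun x => (ψ.commutes x).symm
    haveI : IsScalarTower k (hilbertClassField F) (AlgebraicClosure B) :=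
      IsScalarTower.of_algebraMap_eq fun x => by
        rw [IsScalarTower.algebraMap_apply k B (AlgebraicClosure B), IsScalarTower.algebraMap_apply k B (hilbertClassField F),
          ← IsScalarTower.algebraMap_apply B (hilbertClassField F) (AlgebraicClosure B)]
    haveI : IsScalarTower F (hilbertClassField F) (AlgebraicClosure B) :=
      IsScalarTower.of_algebraMap_eq fun x => rfl
    haveI : Algebra.IsAlgebraic k B := Algebra.IsAlgebraic.of_finite k B
    haveI : Normal k (AlgebraicClosure B) := IsAlgClosure.normal k (AlgebraicClosure B)
    let ω : AlgebraicClosure B ≃ₐ[k] AlgebraicClosure B := (π τ).liftNormal (AlgebraicClosure B)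
    have hω : ∀ x : F, ω (ψF x) = ψF (π τ x) := fun x => AlgEquiv.liftNormal_commutes (π τ) _ x
    haveI : Normal k (hilbertClassField B) := inferInstance
    haveI : IsScalarTower k (hilbertClassField B) (AlgebraicClosure B) :=
      IsScalarTower.of_algebraMap_eq fun _ => rfl
    let τt : hilbertClassField B ≃ₐ[k] hilbertClassField B := ω.restrictNormal (hilbertClassField B)
    have hτt_val : ∀ z : hilbertClassField B, ((τt z : hilbertClassField B) : AlgebraicClosure B) =
        ω (z : AlgebraicClosure B) := fun z => AlgEquiv.restrictNormal_commutes ω (hilbertClassField B) z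
    have hτtsymm_val : ∀ z : hilbertClassField B, ((τt.symm z : hilbertClassField B) : AlgebraicClosure B) =
        ω.symm (z : AlgebraicClosure B) := by
      intro z; apply ω.injective; rw [← hτt_val, AlgEquiv.apply_symm_apply, AlgEquiv.apply_symm_apply]
    let gt : hilbertClassField F ≃ₐ[k] hilbertClassField F := ω.restrictNormal (hilbertClassField F)
    have hgt_val : ∀ z : hilbertClassField F, ψ (gt z) = ω (ψ z) :=
      fun z => AlgEquiv.restrictNormal_commutes ω (hilbertClassField F) z
    have hgtsymm_val : ∀ z : hilbertClassField F, ψ (gt.symm z) = ω.symm (ψ z) := by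
      intro z; apply ω.injective; rw [← hgt_val, AlgEquiv.apply_symm_apply, AlgEquiv.apply_symm_apply]
    -- `g̃` restricts to `π τ` on `F`, `τ̃` restricts to `(π τ)|_B` on `B`
    have hgt_rk : AlgEquiv.restrictNormalHom F gt = π τ := by
      rw [← hrk]
      apply AlgEquiv.ext
      intro x
      have hψinj : Function.Injective (ψ : hilbertClassField F → AlgebraicClosure B) :=
        ψ.toRingHom.injective
      apply (algebraMap F (hilbertClassField F)).injective
      apply hψinj
      rw [hrk_apply, hgt_val]
      exact hω x
    have hτtB : ∀ b : B, τt (algebraMap B (hilbertClassField B) b) =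
        algebraMap B (hilbertClassField B) ((π τ).restrictNormal B b) := by
      intro b
      apply Subtype.ext
      rw [hτt_val]
      change ω (algebraMap B (AlgebraicClosure B) b) = algebraMap B (AlgebraicClosure B) ((π τ).restrictNormal B b)
      rw [IsScalarTower.algebraMap_apply B F (AlgebraicClosure B) b,
        IsScalarTower.algebraMap_apply B F (AlgebraicClosure B) ((π τ).restrictNormal B b),
        AlgEquiv.restrictNormal_commutes]
      exact hω (algebraMap B F b)
    -- the conjugate `a'` of `a₀` by `g̃`
    obtain ⟨a', ha'⟩ := exists_conj' gt a₀
    have hχa' : χ a' = τ • χ a₀ := hχequiv τ gt a₀ a' hgt_rk ha'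
    rw [hμc, ← hχa']
    apply hμ_of
    -- ### the key identity `resP a' = eaut⁻¹ (resPb (Artin (τ • c)))`
    apply eaut.injective
    rw [MulEquiv.apply_symm_apply]
    apply AlgEquiv.ext
    intro y
    apply Subtype.ext
    -- write `y = e x`
    obtain ⟨x, rfl⟩ : ∃ x : P, e x = y := ⟨e.symm y, e.apply_symm_apply y⟩
    -- `τ̃⁻¹ (e x) = e (g̃⁻¹ x)` inside `H_B`
    have hx1 : gt.symm (x : hilbertClassField F) ∈ P := hPstab gt.symm x x.2
    have hstep : τt.symm (algebraMap Pb (hilbertClassField B) (e x)) =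
        algebraMap Pb (hilbertClassField B) (e ⟨gt.symm (x : hilbertClassField F), hx1⟩) := by
      apply Subtype.ext
      simp only [hτtsymm_val, hincl_val, he_val]
      exact (hgtsymm_val _).symm
    have lhs : ((eaut (resP a') (e x) : Pb) : AlgebraicClosure B) =
        ω (ψ (a₀ (gt.symm (x : hilbertClassField F)))) := by
      rw [heaut, AlgEquiv.symm_apply_apply, he_val, hresP_val, ha', hgt_val]
    rw [lhs]
    symm
    rw [hresPb_val, artinEquiv_mulEquiv_intAut_apply B τt ((π τ).restrictNormal B) hτtB c, hτt_val,
      hstep, ← hresPb_val, hPbArt, heaut, AlgEquiv.symm_apply_apply, he_val, hresP_val]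
  -- ### conclusion
  have hμ0 : μ' = 0 := h0 μ' hμequiv
  obtain ⟨h, hh⟩ := hresPb_surj (eaut (resP a))
  have hca : μ ((artinEquiv B).symm h) = χ a :=
    hμ_of _ a (by rw [MulEquiv.apply_symm_apply, hh, MulEquiv.symm_apply_apply])
  rw [← hca]
  exact DFunLike.congr_fun hμ0 (Additive.ofMul ((artinEquiv B).symm h))

/-- **THE EQUIVARIANT IWASAWA LEMMA (class-group hypotheses).**  `k ⊆ B ⊆ F` number fields, `F/k` and
`B/k` Galois, `[F : B] = p` prime, `Gal(F/B)` central in `Gal(F/k)`, `F/B` unramified at the infinite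
places; `Γ` acts on the `p`-torsion additive group `V` through `π : Γ ↠ Gal(F/k)`, the elements over
`Gal(F/B)` acting trivially.  IF
(c2*) every `Γ`-equivariant additive `μ : Cl(𝓞_B) → V` is zero (`Hom_Γ(Cl(B), V) = 0`),
(c3*) for every prime `𝔓` of `F` ramified over `B` the vectors fixed by `{τ : π(τ)𝔓 = 𝔓}` are zero, and
some ramified prime of `F` has a number of `Gal(F/k)`-conjugates prime to `p`,
THEN every `Γ`-equivariant additive `f : Cl(𝓞_F) → V` is zero (`Hom_Γ(Cl(F), V) = 0`).
For `V` trivial this is Iwasawa's «`p ∤ h_B`, one totally ramified prime `⟹ p ∤ h_F`» (Washington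
Thm. 10.4); for `k = ℚ`, `B = ℚ(E[p])ℚ_n ⊆ F = ℚ(E[p])ℚ_{n+1}`, `V = E[p]` (`p ∤ #Gal(ℚ(E[p])/ℚ)`,
`E(ℚ_p)[p] = 0`) it is the step `Hom_G(Cl(L_n), E[p]) = 0 ⟹ Hom_G(Cl(L_{n+1}), E[p]) = 0` feeding
hypothesis (c2) of Deo–Ray–Sujatha at every layer.  Washington's §13.3 argument made equivariant
(`EquivariantIwasawaLemma.lean`) combined with equivariant Artin reciprocity for `B`
(`inertiaTrivialHom_eq_zero_of_classGroupHom_eq_zero`).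
[cite: Washington1997, §13.3 Lemmas 13.14–13.15 and Thm. 10.4 (proof)]
[cite: NeukirchANT1999, Ch. VI (6.9), (7.1) and Ch. IV §6 (equivariance of the Artin symbol)] -/
theorem equivariantHom_classGroup_eq_zero_of_cyclic_layer_of_classGroup (p : ℕ) [Fact p.Prime]
    (hdeg : Module.finrank B F = p)
    (hcent : ∀ (σ : F ≃ₐ[B] F) (τ : F ≃ₐ[k] F) (x : F), τ (σ x) = σ (τ x))
    {Γ : Type*} [Group Γ] (π : Γ →* (F ≃ₐ[k] F)) (hπ : Function.Surjective π)
    {V : Type*} [AddCommGroup V] [DistribMulAction Γ V] (hpV : ∀ v : V, p • v = 0)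
    (hV : ∀ τ : Γ, (∀ x : B, π τ (algebraMap B F x) = algebraMap B F x) → ∀ v : V, τ • v = v)
    (h0 : ∀ μ : Additive (ClassGroup (𝓞 B)) →+ V,
      (∀ (τ : Γ) (c : ClassGroup (𝓞 B)),
        μ (Additive.ofMul (ClassGroup.mulEquiv (AmbiguousClass.intAut ((π τ).restrictNormal B)) c)) =
          τ • μ (Additive.ofMul c)) → μ = 0)
    (hD : ∀ (𝔓 : Ideal (𝓞 F)) [𝔓.IsMaximal], 𝔓.ramificationIdx (𝓞 B) ≠ 1 →
      ∀ v : V, (∀ τ : Γ, π τ • 𝔓 = 𝔓 → τ • v = v) → v = 0)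
    (horb : ∃ (𝔓₀ : Ideal (𝓞 F)) (_ : 𝔓₀.IsMaximal), 𝔓₀.ramificationIdx (𝓞 B) ≠ 1 ∧
      ¬ p ∣ (MulAction.stabilizer (F ≃ₐ[k] F) 𝔓₀).index)
    (f : Additive (ClassGroup (𝓞 F)) →+ V)
    (hf : ∀ (τ : Γ) (c : ClassGroup (𝓞 F)),
      f (Additive.ofMul (ClassGroup.mulEquiv (AmbiguousClass.intAut (π τ)) c)) = τ • f (Additive.ofMul c)) :
    f = 0 :=
  equivariantHom_classGroup_eq_zero_of_cyclic_layer p hdeg hcent π hπ hpV hV hD horb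
    (fun χ hχadd hχI hχequiv =>
      inertiaTrivialHom_eq_zero_of_classGroupHom_eq_zero π hπ h0 χ hχadd
        (fun Q _ => hχI Q) hχequiv)
    f hf

end ClassGroup

end EquivariantIwasawaLemma

end Literature.NumberTheory.NumberFields

end
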